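import Mathlib
import HarnessLib
import Summits.HubbardSuperconductivity.HubbardSuperconductivity.Theorems.ComplexGFFStiffnessHypACumulantHolomorphicNextH
import Summits.HubbardSuperconductivity.HubbardSuperconductivity.Theorems.ComplexGFFStiffnessHypACumulantHolomorphicIntegral

/-!
# Crux `HypACumulant`, line `gnv` — structural pass, brick S6a: `K_{k+1} = nextK` ((6.34)) is holomorphic
# along the complex line `(H + σU, K + σV)` (pointwise in the polymer and the field), given a uniform
# integrable bound of the intermediate functional on the disc

Route `route-HubbardSuperconductivity-ComplexGFFStiffness`, cruxes stmt-HubbardSuperconductivity-19154 /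
-19155, shared research statement `OnePointLipschitz`, census (C3d′) (memo §8, step S6a).  [ABKM19] (6.34):
`K_{k+1}(U, φ) = Σ_X Ĩ^{U∖X}(φ) (Ĩ^{X∖U}(φ))⁻¹ ∫ Φ(X, φ, ξ) μ_{k+1}(dξ)`.  Along the line the intermediate
Hamiltonian is affine, `Ĩ_σ = e^{−(H̃+σŨ)}` (`…HolomorphicNextH.nextH_line`), the prefactors are entire and
nonvanishing (`bprod_expNegH_ne_zero`), `Φ_σ` is entire in `σ` (`…HolomorphicMidK`), and the fluctuation
integral is holomorphic by dominated holomorphy (`…HolomorphicIntegral`) under the ONE model-specific input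
kept as a hypothesis here: a `σ`-uniform `μ`-integrable bound of `Φ_σ(X, φ, ·)` on the disc (for the torus
data this is the integrability estimate of `FlowStepIntegrability`, uniform because `(H+σU, K+σV)` stays in
the norm ball):

* `bprod_expNegH_ne_zero`, `differentiable_bprod_expNegH_inv_line`;
* **`differentiableOn_nextK_line`** — `σ ↦ nextK s π μ (e^{−(H+σU)}) (e^{−(H̃+σŨ)}) (K + σV) U φ` is
  holomorphic on the disc `|σ| < R`.

With `nextH_line` this is the pointwise holomorphy of `σ ↦ nextKStep D (H+σU) (K+σV)`, the first input of
`…HolomorphicPointwise.differentiableOn_iteratedFDeriv_apply_of_pointwise`.  All proved, no `sorry`.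

## References
* S. Adams, S. Buchholz, R. Kotecký, S. Müller, arXiv:1910.13564, Definition 6.5 (6.34) [AdamsBuchholzKoteckyMuller2019].
-/

noncomputable section

-- `Summit.<Summit>.<Problem>`: single-conjunct summit, the duplicate component is mandated (D-0017).
set_option linter.dupNamespace false

namespace Summit.HubbardSuperconductivity.HubbardSuperconductivity.Theorems.ComplexGFF

open MeasureTheory Metric Set
open Literature.MathematicalPhysics.StatisticalMechanics.GradientRG
open Literature.MathematicalPhysics.StatisticalMechanics.TorusPolymer (bprod blocks pcirc polys)
open Literature.MathematicalPhysics.StatisticalMechanics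

variable {d M : ℕ} [NeZero M]

/-- block products of `e^{−H'(B,φ)}` never vanish. -/
theorem bprod_expNegH_ne_zero (s : ℕ) (H' : RelevantHamiltonian ℂ d) (Z : Finset (Fin d → ZMod M))
    (φ : (Fin d → ZMod M) → ℝ) : bprod s (fun B => expNegH H' B φ) Z ≠ 0 := by
  unfold bprod expNegH
  exact Finset.prod_ne_zero_iff.mpr fun B _ => Complex.exp_ne_zero _

/-- the inverse prefactor `((e^{−(H̃+σŨ)})^{Z}(φ))⁻¹` is entire in `σ`. -/
theorem differentiable_bprod_expNegH_inv_line (s : ℕ) (Ht Ut : RelevantHamiltonian ℂ d)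
    (Z : Finset (Fin d → ZMod M)) (φ : (Fin d → ZMod M) → ℝ) :
    Differentiable ℂ (fun σ : ℂ => (bprod s (fun B => expNegH (Ht + σ • Ut) B φ) Z)⁻¹) :=
  (differentiable_bprod_expNegH_line s Ht Ut Z φ).inv fun _ => bprod_expNegH_ne_zero s _ Z φ

/-- **`K_{k+1}` is holomorphic along the line `(H + σU, K + σV)`** (pointwise in `U, φ`), with the
intermediate Hamiltonian family `H̃ + σŨ`, given a `σ`-uniform integrable bound and measurability of the
intermediate functional `Φ_σ(X, φ, ·)` for every `X`. -/
theorem differentiableOn_nextK_line (s : ℕ) (π : Finset (Fin d → ZMod M) → Finset (Fin d → ZMod M))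
    (μ : Measure ((Fin d → ZMod M) → ℝ)) (H U Ht Ut : RelevantHamiltonian ℂ d)
    (K V : Finset (Fin d → ZMod M) → ((Fin d → ZMod M) → ℝ) → ℂ)
    (U' : Finset (Fin d → ZMod M)) (φ : (Fin d → ZMod M) → ℝ) {R : ℝ}
    (hmeas : ∀ X σ, AEStronglyMeasurable (fun ξ =>
      midK s (expNegH (H + σ • U)) (expNegH (Ht + σ • Ut)) (fun Y ψ => K Y ψ + σ * V Y ψ) X φ ξ) μ)
    (hdom : ∀ X, ∃ G : ((Fin d → ZMod M) → ℝ) → ℝ, Integrable G μ ∧ ∀ σ ∈ ball (0 : ℂ) R, ∀ ξ,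
      ‖midK s (expNegH (H + σ • U)) (expNegH (Ht + σ • Ut)) (fun Y ψ => K Y ψ + σ * V Y ψ) X φ ξ‖ ≤ G ξ) :
    DifferentiableOn ℂ (fun σ : ℂ =>
      nextK s π μ (expNegH (H + σ • U)) (expNegH (Ht + σ • Ut)) (fun Y ψ => K Y ψ + σ * V Y ψ) U' φ) (ball (0 : ℂ) R) := by
  unfold nextK
  refine DifferentiableOn.fun_sum fun X _ => ?_
  refine DifferentiableOn.mul (DifferentiableOn.mul ?_ ?_) ?_
  · exact (differentiable_bprod_expNegH_line s Ht Ut (U' \ X) φ).differentiableOn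
  · exact (differentiable_bprod_expNegH_inv_line s Ht Ut (X \ U') φ).differentiableOn
  · obtain ⟨G, hGi, hG⟩ := hdom X
    exact differentiableOn_integral_of_dominated_holomorphic (fun σ _ => hmeas X σ)
      (ae_of_all _ fun ξ => (differentiable_midK_line s H U Ht Ut K V X φ ξ).differentiableOn)
      (ae_of_all _ fun ξ σ hσ => hG σ hσ ξ) hGi

end Summit.HubbardSuperconductivity.HubbardSuperconductivity.Theorems.ComplexGFF

end
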